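import Summits.CriticalPhenomena.Ising3DConformalLimit.Theorems.FKFourConnectivity.Negative.LebowitzSandwich
import Literature.Probability.LatticeModels.RandomClusterProofs
import Literature.Probability.LatticeModels.CriticalUrsellFourSign

/-!
# `FKFourConnectivity` — negative-side lemmas, II: Edwards–Sokal for the four-point function and
the Lebowitz sandwich `|U₄| ≤ 2P₄` in spin language

Split of the standing disprover's work file
`Summits/CriticalPhenomena/Ising3DConformalLimit/Cruxes/FKFourConnectivity/Disproof.lean`
(crux `stmt-CriticalPhenomena-11254`, route `FKParityRobustness`). Nothing here asserts the crux.

* `edwardsSokal_fourPoint`: for the free, zero-field Ising model on a finite graph at `β ≥ 0`,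
  `⟨σ_{a0}σ_{a1}σ_{a2}σ_{a3}⟩ = φ_{G,1−e^{−2β},2}(EVEN)`, `EVEN` = "every open cluster holds an even
  number of the aᵢ" = the union of the three pairing events (Edwards–Sokal 1988; Grimmett 2006,
  Thm 1.16 run with four points: the spin sum over cluster-constant configurations is `2^{k(ω)}`
  when a pairing is realised and `0` otherwise, by flipping a cluster holding an odd number of the
  marked sites). This is the dictionary entry `⟨σ_A⟩^free_G = φ(F_A)` the route's `ParityBound`
  (stmt-CriticalPhenomena-8466) starts from.
* `neg_two_mul_allJoined_le_connectedFour`: `−2·φ(ALL) ≤ U₄^free_G(a)` on every finite graph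
  (Aizenman 1982, Prop. 5.3, `|U₄| ≤ 2P₄`, here from Part I's FK sandwich + Edwards–Sokal).
* `allJoined_le_sum_pairProducts`: the ceiling `φ(ALL) ≤ Σ_π φ(a_i↔a_j)φ(a_k↔a_l)` on every
  finite graph (`ALL ⊆ EVEN`, Edwards–Sokal, Lebowitz `U₄ ≤ 0` = `lebowitz_holds`): for the crux's
  tetrahedron `P₄/(G₀₁G₂₃) ≤ 3`, no constant `c > 3` can work.
* `not_FKFourConnectivity_imp_pointwise_triviality`: hence a failure of the crux means
  `−U₄^free_{Λ_N}(A_l) < 2c⟨σσ⟩⟨σσ⟩` for every `c > 0` along tetrahedra in arbitrarily large boxes —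
  pointwise triviality of critical 3D Ising at tetrahedral configurations. A disproof of the crux
  is a triviality theorem; this is why the standing disprover reports "no kill".

## References

* R. G. Edwards, A. D. Sokal, Phys. Rev. D 38 (1988) 2009–2012 [EdwardsSokal1988].
* G. Grimmett, *The Random-Cluster Model*, Springer 2006, §1.4, Thm 1.10, Thm 1.16 [Grimmett2006].
* M. Aizenman, Comm. Math. Phys. 86 (1982) 1–48, Prop. 5.3 [AizenmanCMP1982].
-/

namespace Summit.CriticalPhenomena.Ising3DConformalLimit.Theorems.FKFourConnectivity.Negative

open MeasureTheory Finset
open Literature.Probability.LatticeModels Literature.Probability.Percolation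

noncomputable section

section EdwardsSokalFour

variable {V : Type*} [Fintype V] [DecidableEq V]

/-- Abstract sign-reversing involution: if `φ` is an involution of the configurations preserving
the event `F` and reversing the sign of `f`, then `∑_σ 1_F(σ) f(σ) = 0`
(Grimmett 2006, proof of Thm. 1.16). [cite: Grimmett2006, §1.4 Thm. 1.16] -/
theorem sum_boole_mul_eq_zero_of_involutive (F : SpinConfig V → Prop) [DecidablePred F]
    (f : SpinConfig V → ℝ) (φ : SpinConfig V → SpinConfig V) (hφ : Function.Involutive φ)
    (hF : ∀ σ, F (φ σ) ↔ F σ) (hf : ∀ σ, f (φ σ) = -f σ) :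
    ∑ σ : SpinConfig V, (if F σ then (1 : ℝ) else 0) * f σ = 0 := by
  have hS : ∑ σ : SpinConfig V, (if F σ then (1 : ℝ) else 0) * f σ =
      ∑ σ : SpinConfig V, (if F (φ σ) then (1 : ℝ) else 0) * f (φ σ) :=
    (Fintype.sum_equiv (Function.Involutive.toPerm φ hφ) _ _ fun σ => rfl).symm
  simp_rw [hF, hf, mul_neg, Finset.sum_neg_distrib] at hS
  linarith

/-- **The cluster flip with four marked sites** (Grimmett 2006, proof of Thm. 1.16, run with four
points): if no pairing of `a 0, …, a 3` is realised by the open clusters of `ω`, there is an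
involution of the spin configurations (flip the cluster of a site whose cluster holds an odd number
of the marked sites) preserving "constant along open edges" and reversing the sign of
`σ_{a0}σ_{a1}σ_{a2}σ_{a3}`. [cite: Grimmett2006, §1.4 Thm. 1.16] -/
theorem exists_signFlip (ω : Finset (Sym2 V)) {a : Fin 4 → V}
    (h : ¬ (((openGraph (↑ω : BondConfig V)).Reachable (a 0) (a 1) ∧ (openGraph (↑ω : BondConfig V)).Reachable (a 2) (a 3)) ∨
      ((openGraph (↑ω : BondConfig V)).Reachable (a 0) (a 2) ∧ (openGraph (↑ω : BondConfig V)).Reachable (a 1) (a 3)) ∨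
      ((openGraph (↑ω : BondConfig V)).Reachable (a 0) (a 3) ∧ (openGraph (↑ω : BondConfig V)).Reachable (a 1) (a 2)))) :
    ∃ φ : SpinConfig V → SpinConfig V, Function.Involutive φ ∧
      (∀ σ, (∀ e ∈ ω, bondSpin (φ σ) e = 1) ↔ ∀ e ∈ ω, bondSpin σ e = 1) ∧
      ∀ σ, spinMonomial a (φ σ) = -spinMonomial a σ := by
  classical
  set H : SimpleGraph V := openGraph (↑ω : BondConfig V) with hH
  -- the flip of the cluster of `v`
  let flip : V → SpinConfig V → SpinConfig V := fun v σ w => if H.Reachable v w then -σ w else σ w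
  have hinv : ∀ v, Function.Involutive (flip v) := by
    intro v σ
    funext w
    by_cases hw : H.Reachable v w <;> simp [flip, hw]
  have key : ∀ (v : V) {x y : V}, H.Adj x y → (H.Reachable v x ↔ H.Reachable v y) := fun v _ _ hxy =>
    ⟨fun h' => h'.trans hxy.reachable, fun h' => h'.trans hxy.symm.reachable⟩
  have hF : ∀ v σ, (∀ e ∈ ω, bondSpin (flip v σ) e = 1) ↔ ∀ e ∈ ω, bondSpin σ e = 1 := by
    intro v σ
    rw [forall_bondSpin_eq_one_iff, forall_bondSpin_eq_one_iff]
    constructor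
    · intro h' x y hxy
      have hxy' := h' hxy
      by_cases hx : H.Reachable v x
      · have hy : H.Reachable v y := (key v hxy).1 hx
        simp only [flip, if_pos hx, if_pos hy, neg_inj] at hxy'
        exact hxy'
      · have hy : ¬ H.Reachable v y := fun hy => hx ((key v hxy).2 hy)
        simp only [flip, if_neg hx, if_neg hy] at hxy'
        exact hxy'
    · intro h' x y hxy
      by_cases hx : H.Reachable v x
      · have hy : H.Reachable v y := (key v hxy).1 hx
        simp only [flip, if_pos hx, if_pos hy, h' hxy]
      · have hy : ¬ H.Reachable v y := fun hy => hx ((key v hxy).2 hy)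
        simp only [flip, if_neg hx, if_neg hy, h' hxy]
  have pos : ∀ {v w : V}, H.Reachable v w → ∀ σ, spinAt w (flip v σ) = -spinAt w σ := by
    intro v w hw σ
    simp [spinAt, flip, if_pos hw]
  have neg : ∀ {v w : V}, ¬ H.Reachable v w → ∀ σ, spinAt w (flip v σ) = spinAt w σ := by
    intro v w hw σ
    simp [spinAt, flip, if_neg hw]
  -- it suffices to find `v` whose cluster holds an odd number of marked sites
  suffices hv : ∃ v : V, ∀ σ, spinMonomial a (flip v σ) = -spinMonomial a σ by
    obtain ⟨v, hv⟩ := hv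
    exact ⟨flip v, hinv v, hF v, hv⟩
  have r00 : H.Reachable (a 0) (a 0) := SimpleGraph.Reachable.refl _
  have r11 : H.Reachable (a 1) (a 1) := SimpleGraph.Reachable.refl _
  have r22 : H.Reachable (a 2) (a 2) := SimpleGraph.Reachable.refl _
  by_cases r01 : H.Reachable (a 0) (a 1) <;> by_cases r02 : H.Reachable (a 0) (a 2) <;>
    by_cases r03 : H.Reachable (a 0) (a 3)
  · exact absurd (Or.inl ⟨r01, r02.symm.trans r03⟩) h
  · refine ⟨a 0, fun σ => ?_⟩
    simp only [spinMonomial, Fin.prod_univ_four, pos r00, pos r01, pos r02, neg r03]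
    ring
  · refine ⟨a 0, fun σ => ?_⟩
    simp only [spinMonomial, Fin.prod_univ_four, pos r00, pos r01, neg r02, pos r03]
    ring
  · -- only 0~1: flip the cluster of a 2
    have r20 : ¬ H.Reachable (a 2) (a 0) := fun h' => r02 h'.symm
    have r21 : ¬ H.Reachable (a 2) (a 1) := fun h' => r02 (r01.trans h'.symm)
    have r23 : ¬ H.Reachable (a 2) (a 3) := fun h' => h (Or.inl ⟨r01, h'⟩)
    refine ⟨a 2, fun σ => ?_⟩
    simp only [spinMonomial, Fin.prod_univ_four, neg r20, neg r21, pos r22, neg r23]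
    ring
  · refine ⟨a 0, fun σ => ?_⟩
    simp only [spinMonomial, Fin.prod_univ_four, pos r00, neg r01, pos r02, pos r03]
    ring
  · -- only 0~2: flip the cluster of a 1
    have r10 : ¬ H.Reachable (a 1) (a 0) := fun h' => r01 h'.symm
    have r12 : ¬ H.Reachable (a 1) (a 2) := fun h' => r01 (r02.trans h'.symm)
    have r13 : ¬ H.Reachable (a 1) (a 3) := fun h' => h (Or.inr (Or.inl ⟨r02, h'⟩))
    refine ⟨a 1, fun σ => ?_⟩
    simp only [spinMonomial, Fin.prod_univ_four, neg r10, pos r11, neg r12, neg r13]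
    ring
  · -- only 0~3: flip the cluster of a 1
    have r10 : ¬ H.Reachable (a 1) (a 0) := fun h' => r01 h'.symm
    have r12 : ¬ H.Reachable (a 1) (a 2) := fun h' => h (Or.inr (Or.inr ⟨r03, h'⟩))
    have r13 : ¬ H.Reachable (a 1) (a 3) := fun h' => r01 (r03.trans h'.symm)
    refine ⟨a 1, fun σ => ?_⟩
    simp only [spinMonomial, Fin.prod_univ_four, neg r10, pos r11, neg r12, neg r13]
    ring
  · refine ⟨a 0, fun σ => ?_⟩
    simp only [spinMonomial, Fin.prod_univ_four, pos r00, neg r01, neg r02, neg r03]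
    ring

/-- Even case of the spin sum (Grimmett 2006, proof of Thm. 1.16, four points): if some pairing of
the marked vertices is realised by the clusters of `ω`, every cluster-constant configuration has
`σ_{a0}σ_{a1}σ_{a2}σ_{a3} = 1`, so `∑_σ 1_F(σ, ω) σ_A = 2^{k(ω)}`. [cite: Grimmett2006, §1.4 Thm. 1.16] -/
theorem sum_boole_bondSpin_mul_spinMonomial_of_even (ω : Finset (Sym2 V)) {a : Fin 4 → V}
    (h : ((openGraph (↑ω : BondConfig V)).Reachable (a 0) (a 1) ∧ (openGraph (↑ω : BondConfig V)).Reachable (a 2) (a 3)) ∨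
      ((openGraph (↑ω : BondConfig V)).Reachable (a 0) (a 2) ∧ (openGraph (↑ω : BondConfig V)).Reachable (a 1) (a 3)) ∨
      ((openGraph (↑ω : BondConfig V)).Reachable (a 0) (a 3) ∧ (openGraph (↑ω : BondConfig V)).Reachable (a 1) (a 2))) :
    ∑ σ : SpinConfig V, (if ∀ e ∈ ω, bondSpin σ e = 1 then (1 : ℝ) else 0) * spinMonomial a σ =
      (2 : ℝ) ^ clusterCount (↑ω : BondConfig V) ∅ := by
  rw [← sum_boole_bondSpin_eq ω]
  refine Finset.sum_congr rfl fun σ _ => ?_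
  split_ifs with hF
  · rw [one_mul]
    have hconst := (forall_bondSpin_eq_one_iff ω σ).1 hF
    have key : ∀ {x y : V}, (openGraph (↑ω : BondConfig V)).Reachable x y → spinAt x σ = spinAt y σ :=
      fun hxy => by simp [spinAt, apply_eq_of_reachable hconst hxy]
    simp only [spinMonomial, Fin.prod_univ_four]
    rcases h with ⟨h01, h23⟩ | ⟨h02, h13⟩ | ⟨h03, h12⟩
    · rw [key h01, key h23]
      rcases spinAt_eq_one_or_eq_neg_one (a 1) σ with h1 | h1 <;>
        rcases spinAt_eq_one_or_eq_neg_one (a 3) σ with h3 | h3 <;> norm_num [h1, h3]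
    · rw [key h02, key h13]
      rcases spinAt_eq_one_or_eq_neg_one (a 2) σ with h1 | h1 <;>
        rcases spinAt_eq_one_or_eq_neg_one (a 3) σ with h3 | h3 <;> norm_num [h1, h3]
    · rw [key h03, key h12]
      rcases spinAt_eq_one_or_eq_neg_one (a 2) σ with h1 | h1 <;>
        rcases spinAt_eq_one_or_eq_neg_one (a 3) σ with h3 | h3 <;> norm_num [h1, h3]
  · rw [zero_mul]

/-- Odd case of the spin sum (Grimmett 2006, proof of Thm. 1.16, four points): if no pairing is
realised, `∑_σ 1_F(σ, ω) σ_A = 0` by the cluster flip `exists_signFlip`. [cite: Grimmett2006, §1.4 Thm. 1.16] -/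
theorem sum_boole_bondSpin_mul_spinMonomial_of_not_even (ω : Finset (Sym2 V)) {a : Fin 4 → V}
    (h : ¬ (((openGraph (↑ω : BondConfig V)).Reachable (a 0) (a 1) ∧ (openGraph (↑ω : BondConfig V)).Reachable (a 2) (a 3)) ∨
      ((openGraph (↑ω : BondConfig V)).Reachable (a 0) (a 2) ∧ (openGraph (↑ω : BondConfig V)).Reachable (a 1) (a 3)) ∨
      ((openGraph (↑ω : BondConfig V)).Reachable (a 0) (a 3) ∧ (openGraph (↑ω : BondConfig V)).Reachable (a 1) (a 2)))) :
    ∑ σ : SpinConfig V, (if ∀ e ∈ ω, bondSpin σ e = 1 then (1 : ℝ) else 0) * spinMonomial a σ = 0 := by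
  classical
  obtain ⟨φ, hφ, hF, hneg⟩ := exists_signFlip ω h
  exact sum_boole_mul_eq_zero_of_involutive (fun σ => ∀ e ∈ ω, bondSpin σ e = 1) (spinMonomial a) φ hφ hF hneg

variable (G : SimpleGraph V) [DecidableRel G.Adj]

omit [Fintype V] [DecidableEq V] in
/-- Exchange of the `σ`- and `ω`-sums in the numerator. [folklore] -/
theorem sum_mul_sum_mul_comm₄ {ι κ : Type*} (s : Finset ι) (t : Finset κ) (c : ℝ) (W : κ → ℝ)
    (b : κ → ι → ℝ) (g : ι → ℝ) :
    ∑ i ∈ s, (c * ∑ k ∈ t, W k * b k i) * g i = c * ∑ k ∈ t, W k * ∑ i ∈ s, b k i * g i := by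
  simp_rw [Finset.mul_sum, Finset.sum_mul]
  rw [Finset.sum_comm]
  refine Finset.sum_congr rfl fun k _ => Finset.sum_congr rfl fun i _ => ?_
  ring

omit [Fintype V] [DecidableEq V] in
/-- Exchange of the `σ`- and `ω`-sums in the partition function. [folklore] -/
theorem sum_mul_sum_comm₄ {ι κ : Type*} (s : Finset ι) (t : Finset κ) (c : ℝ) (W : κ → ℝ)
    (b : κ → ι → ℝ) :
    ∑ i ∈ s, c * ∑ k ∈ t, W k * b k i = c * ∑ k ∈ t, W k * ∑ i ∈ s, b k i := by
  simp_rw [Finset.mul_sum]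
  rw [Finset.sum_comm]

/-- **Edwards–Sokal identity for the four-point function** (Edwards–Sokal 1988; Grimmett 2006,
Thm. 1.16, four points; Aizenman 1982, §5): for the free-boundary, zero-field Ising model on a
finite graph at `β ≥ 0`,
`⟨σ_{a0}σ_{a1}σ_{a2}σ_{a3}⟩ = φ_{G,1-e^{-2β},2}(every open cluster holds an even number of the aᵢ)`,
the event being the union of the three pairing events `{a_i↔a_j} ∩ {a_k↔a_l}`.
[cite: Grimmett2006, §1.4 Thm. 1.16] -/
theorem edwardsSokal_fourPoint {β : ℝ} (hβ : 0 ≤ β) (a : Fin 4 → V) :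
    isingExpect G univ β 0 .free (spinMonomial a) =
      (rcMeasure G (fkIsingParam β) 2 ∅).real
        (((openConn (a 0) (a 1) ∩ openConn (a 2) (a 3)) ∪ (openConn (a 0) (a 2) ∩ openConn (a 1) (a 3))) ∪
          (openConn (a 0) (a 3) ∩ openConn (a 1) (a 2))) := by
  classical
  have hp : fkIsingParam β ∈ Set.Icc (0 : ℝ) 1 := fkIsingParam_mem_Icc hβ
  have hq : (0 : ℝ) < 2 := two_pos
  have hc : (0 : ℝ) < Real.exp β ^ #G.edgeFinset := pow_pos (Real.exp_pos β) _
  rw [rcMeasure_real_apply G hp hq ∅, ← Finset.sum_filter, ← Finset.sum_div, Finset.sum_filter,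
    isingExpect_univ_free_eq G β (measurable_spinMonomial a)]
  simp_rw [exp_mul_sum_bondSpin_eq G β]
  rw [sum_mul_sum_mul_comm₄, sum_mul_sum_comm₄, mul_div_mul_left _ _ hc.ne']
  congr 1
  · refine Finset.sum_congr rfl fun ω _ => ?_
    by_cases hr : ((openGraph (↑ω : BondConfig V)).Reachable (a 0) (a 1) ∧ (openGraph (↑ω : BondConfig V)).Reachable (a 2) (a 3)) ∨
      ((openGraph (↑ω : BondConfig V)).Reachable (a 0) (a 2) ∧ (openGraph (↑ω : BondConfig V)).Reachable (a 1) (a 3)) ∨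
      ((openGraph (↑ω : BondConfig V)).Reachable (a 0) (a 3) ∧ (openGraph (↑ω : BondConfig V)).Reachable (a 1) (a 2))
    · have hmem : (↑ω : BondConfig V) ∈ (((openConn (a 0) (a 1) ∩ openConn (a 2) (a 3)) ∪
          (openConn (a 0) (a 2) ∩ openConn (a 1) (a 3))) ∪ (openConn (a 0) (a 3) ∩ openConn (a 1) (a 2))) := by
        simpa [Set.mem_union, Set.mem_inter_iff, openConn, or_assoc] using hr
      rw [if_pos hmem, sum_boole_bondSpin_mul_spinMonomial_of_even ω hr]
      rfl
    · have hmem : (↑ω : BondConfig V) ∉ (((openConn (a 0) (a 1) ∩ openConn (a 2) (a 3)) ∪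
          (openConn (a 0) (a 2) ∩ openConn (a 1) (a 3))) ∪ (openConn (a 0) (a 3) ∩ openConn (a 1) (a 2))) := by
        simpa [Set.mem_union, Set.mem_inter_iff, openConn, or_assoc] using hr
      rw [if_neg hmem, sum_boole_bondSpin_mul_spinMonomial_of_not_even ω hr, mul_zero]
  · unfold rcPartitionFunction
    refine Finset.sum_congr rfl fun ω _ => ?_
    rw [sum_boole_bondSpin_eq]
    rfl

/-- **`|U₄| ≤ 2P₄` on every finite graph** (Aizenman 1982, Prop. 5.3, in FK dress): for the free,
zero-field Ising model on a finite graph at `β ≥ 0` and any four sites `a`,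
`−2·φ_{G,p,2}(a all joined) ≤ U₄(a) = ⟨σ_A⟩ − Σ_π ⟨σσ⟩⟨σσ⟩`, `p = 1 − e^{−2β}`; Edwards–Sokal (two-
and four-point) + Part I's FK sandwich. With the route's `ParityBound` (`U₄ ≤ −2∫u dφ`) this is the
sandwich `2∫u dφ ≤ |U₄| ≤ 2P₄`. [cite: AizenmanCMP1982, Prop. 5.3] -/
theorem neg_two_mul_allJoined_le_connectedFour {β : ℝ} (hβ : 0 ≤ β) (a : Fin 4 → V) :
    -(2 * (rcMeasure G (fkIsingParam β) 2 ∅).real {ω | ∀ i j, (openGraph ω).Reachable (a i) (a j)}) ≤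
      connectedFour (isingMeasure G univ β 0 .free) spinAt a := by
  have hp : fkIsingParam β ∈ Set.Icc (0 : ℝ) 1 := fkIsingParam_mem_Icc hβ
  have hq : (1 : ℝ) ≤ 2 := by norm_num
  have h4 : nPoint (isingMeasure G univ β 0 .free) spinAt a =
      (rcMeasure G (fkIsingParam β) 2 ∅).real
        (((openConn (a 0) (a 1) ∩ openConn (a 2) (a 3)) ∪ (openConn (a 0) (a 2) ∩ openConn (a 1) (a 3))) ∪
          (openConn (a 0) (a 3) ∩ openConn (a 1) (a 2))) :=
    edwardsSokal_fourPoint G hβ a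
  have h2 : ∀ x y : V, twoPoint (isingMeasure G univ β 0 .free) spinAt x y =
      (rcMeasure G (fkIsingParam β) 2 ∅).real (openConn x y) := fun x y =>
    edwardsSokal_twoPoint_holds G hβ x y
  have hs := pairProducts_sub_even_le_two_mul_allJoined G hp hq ∅ a
  simp only [connectedFour, h4, h2]
  linarith

/-- **Ceiling on the crux's constant** (Lebowitz 1974 / Aizenman 1982 Prop. 5.2 in FK dress): on
every finite graph, `φ_{G,p,2}(ALL) ≤ φ(EVEN) = ⟨σ_A⟩ ≤ Σ_π ⟨σσ⟩⟨σσ⟩ = Σ_π φ(a_i↔a_j)φ(a_k↔a_l)`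
(`ALL ⊆ EVEN`, Edwards–Sokal four-point, Lebowitz `U₄ ≤ 0` = `lebowitz_holds`, Edwards–Sokal
two-point). For the crux's tetrahedron the six pair-connectivities coincide (cubic symmetry), so
`r(l) = P₄/(G₀₁G₂₃) ≤ 3`: no constant `c > 3` can ever work — the statement is tight up to the value of
`r* ∈ (0, 3]`. [cite: Lebowitz1974, Theorem, eq. (2.5b)] -/
theorem allJoined_le_sum_pairProducts {β : ℝ} (hβ : 0 ≤ β) (a : Fin 4 → V) :
    (rcMeasure G (fkIsingParam β) 2 ∅).real {ω | ∀ i j, (openGraph ω).Reachable (a i) (a j)} ≤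
      (rcMeasure G (fkIsingParam β) 2 ∅).real (openConn (a 0) (a 1)) *
          (rcMeasure G (fkIsingParam β) 2 ∅).real (openConn (a 2) (a 3))
        + (rcMeasure G (fkIsingParam β) 2 ∅).real (openConn (a 0) (a 2)) *
          (rcMeasure G (fkIsingParam β) 2 ∅).real (openConn (a 1) (a 3))
        + (rcMeasure G (fkIsingParam β) 2 ∅).real (openConn (a 0) (a 3)) *
          (rcMeasure G (fkIsingParam β) 2 ∅).real (openConn (a 1) (a 2)) := by
  have hp : fkIsingParam β ∈ Set.Icc (0 : ℝ) 1 := fkIsingParam_mem_Icc hβ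
  haveI := isProbabilityMeasure_rcMeasure G hp two_pos (∅ : Set V)
  have hsub : {ω : BondConfig V | ∀ i j, (openGraph ω).Reachable (a i) (a j)} ⊆
      (((openConn (a 0) (a 1) ∩ openConn (a 2) (a 3)) ∪ (openConn (a 0) (a 2) ∩ openConn (a 1) (a 3))) ∪
        (openConn (a 0) (a 3) ∩ openConn (a 1) (a 2))) :=
    fun ω hω => Or.inl (Or.inl ⟨hω 0 1, hω 2 3⟩)
  have hmono := measureReal_mono (μ := rcMeasure G (fkIsingParam β) 2 ∅) hsub (measure_ne_top _ _)
  have h4 : nPoint (isingMeasure G univ β 0 .free) spinAt a =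
      (rcMeasure G (fkIsingParam β) 2 ∅).real
        (((openConn (a 0) (a 1) ∩ openConn (a 2) (a 3)) ∪ (openConn (a 0) (a 2) ∩ openConn (a 1) (a 3))) ∪
          (openConn (a 0) (a 3) ∩ openConn (a 1) (a 2))) :=
    edwardsSokal_fourPoint G hβ a
  have h2 : ∀ x y : V, twoPoint (isingMeasure G univ β 0 .free) spinAt x y =
      (rcMeasure G (fkIsingParam β) 2 ∅).real (openConn x y) := fun x y =>
    edwardsSokal_twoPoint_holds G hβ x y
  have hleb := lebowitz_holds G hβ univ a (fun _ => Finset.mem_univ _)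
  simp only [connectedFour, h4, h2] at hleb
  linarith

end EdwardsSokalFour

/-! ## The crux: what a refutation would mean, in spin language -/

section Crux

open scoped Classical

/-- **What a refutation would mean, in spin language**: if the crux fails, then for every `c > 0`
there are tetrahedra `A_l` (`l ≥ 1`), in arbitrarily large boxes `Λ_N = {−N..N}³`, where the free
finite-volume critical Ising four-point Ursell function on the box graph satisfies
`|U₄^free_{Λ_N}(A_l)| = −U₄ < 2c·⟨σ_{a0}σ_{a1}⟩⟨σ_{a2}σ_{a3}⟩`: pointwise triviality along tetrahedra
for critical 3D Ising, the opposite of what clause (iii) of the conjunct asserts in the limit. So a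
disproof of `FKFourConnectivity` is a (pointwise, tetrahedral) triviality theorem in `d = 3`; and the
crux is implied by any lattice bound `U₄(A_l) ≤ −c⟨σσ⟩⟨σσ⟩` (the hypothesis of the route's
`FarMergingGivesU4`, once transported to finite volume). [cite: AizenmanCMP1982, Prop. 5.3] -/
theorem not_FKFourConnectivity_imp_pointwise_triviality
    (hn : ¬ Summit.CriticalPhenomena.Ising3DConformalLimit.Theses.FKParityRobustness.FKFourConnectivity)
    (c : ℝ) (hc : 0 < c) :
    ∃ l : ℕ, 1 ≤ l ∧ ∀ N₀ : ℕ, ∃ N : ℕ, N₀ ≤ N ∧ ∃ a : Fin 4 → ↥(box 3 N),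
      (∀ i, ((a i : Site 3)) = (l : ℤ) • (![![-1, -1, -1], ![1, 1, -1], ![1, -1, 1], ![-1, 1, 1]] : Fin 4 → Site 3) i) ∧
      -(connectedFour (isingMeasure ((zdGraph 3).comap (Subtype.val : ↥(box 3 N) → Site 3)) univ
          (criticalBeta 3) 0 .free) spinAt a) <
        2 * c * (isingTwoPoint ((zdGraph 3).comap (Subtype.val : ↥(box 3 N) → Site 3)) univ (criticalBeta 3) 0 .free (a 0) (a 1) *
          isingTwoPoint ((zdGraph 3).comap (Subtype.val : ↥(box 3 N) → Site 3)) univ (criticalBeta 3) 0 .free (a 2) (a 3)) := by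
  have hβ : 0 ≤ criticalBeta 3 := criticalBeta_nonneg 3
  by_contra hcon
  push Not at hcon
  apply hn
  refine ⟨c, hc, fun l hl => ?_⟩
  obtain ⟨N₀, hN₀⟩ := hcon l hl
  refine ⟨N₀, fun N hN a ha => ?_⟩
  have h := hN₀ N hN a ha
  have hs := neg_two_mul_allJoined_le_connectedFour ((zdGraph 3).comap (Subtype.val : ↥(box 3 N) → Site 3)) hβ a
  have e01 : isingTwoPoint ((zdGraph 3).comap (Subtype.val : ↥(box 3 N) → Site 3)) univ (criticalBeta 3) 0 .free (a 0) (a 1) =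
      (rcMeasure ((zdGraph 3).comap (Subtype.val : ↥(box 3 N) → Site 3)) (fkIsingParam (criticalBeta 3)) 2 ∅).real
        (openConn (a 0) (a 1)) :=
    edwardsSokal_twoPoint_holds _ hβ (a 0) (a 1)
  have e23 : isingTwoPoint ((zdGraph 3).comap (Subtype.val : ↥(box 3 N) → Site 3)) univ (criticalBeta 3) 0 .free (a 2) (a 3) =
      (rcMeasure ((zdGraph 3).comap (Subtype.val : ↥(box 3 N) → Site 3)) (fkIsingParam (criticalBeta 3)) 2 ∅).real
        (openConn (a 2) (a 3)) :=
    edwardsSokal_twoPoint_holds _ hβ (a 2) (a 3)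
  rw [e01, e23] at h
  change c * (rcMeasure ((zdGraph 3).comap (Subtype.val : ↥(box 3 N) → Site 3)) (fkIsingParam (criticalBeta 3)) 2 ∅).real
      (openConn (a 0) (a 1)) *
      (rcMeasure ((zdGraph 3).comap (Subtype.val : ↥(box 3 N) → Site 3)) (fkIsingParam (criticalBeta 3)) 2 ∅).real
        (openConn (a 2) (a 3)) ≤
      (rcMeasure ((zdGraph 3).comap (Subtype.val : ↥(box 3 N) → Site 3)) (fkIsingParam (criticalBeta 3)) 2 ∅).real
        {ω | ∀ i j, (openGraph ω).Reachable (a i) (a j)}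
  nlinarith [hs, h]

end Crux

end

end Summit.CriticalPhenomena.Ising3DConformalLimit.Theorems.FKFourConnectivity.Negative
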